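import Summits.CriticalPhenomena.PercolationContinuityZ3.Theses.PercTorusSliceFilling
import Literature.Probability.Percolation.MeanFieldBetaFromGamma
import Summits.CriticalPhenomena.PercolationContinuityZ3.Theorems.PercTorusSliceFillingNoCriticalTorusGiantNonSfLargeClusterChart
import Summits.CriticalPhenomena.PercolationContinuityZ3.Theorems.PercTorusSliceFillingNoCriticalTorusGiantNonSfGiantMarkov
import Summits.CriticalPhenomena.PercolationContinuityZ3.Theorems.PercTorusSliceFillingNoCriticalTorusGiantSfGiantSecondMoment
import Summits.CriticalPhenomena.PercolationContinuityZ3.Theorems.PercTorusSliceFillingNoCriticalTorusGiantSfMassTransitive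
import HarnessLib

/-!
# Route `PercTorusSliceFilling`, crux `NoCriticalTorusGiant` — the slice-filling transfer
# S3 ⇒ crux (support file, item stmt-CriticalPhenomena-5407)

The composition of line `birth`/`registered` (leads c1/c2, kernel-checked in the crux skeleton
`Cruxes/NoCriticalTorusGiant/Lines/birth.lean` until lead c3 reshaped it, 2026-08-17) moved into the
tree so that BOTH directions of the certified equivalence live under `Theorems/`:

* `noCriticalTorusGiant_of_sfMass_subextensive` — **S3 ⇒ crux**: if the slice-filling susceptibility
  of the critical 3-torus is subextensive, `n⁻³ · E_{T_n,p_c}[|C(0)| · 1{C(0) slice-filling}] → 0`,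
  then `NoCriticalTorusGiant` (concluded BY NAME).  For `ε > 0` and `n ≥ 3` put `k = ⌈ε n³⌉`;
  an `ε`-giant is slice-filling or not; the landed stubs S2a `stub_sfGiantSecondMoment` + S2b
  `stub_sfMassTransitive` bound the first case by `ε⁻² · E[|C(0)|; sf]/n³`, and S1b
  `stub_nonSfGiantMarkov` + S1a `stub_nonSfLargeClusterChart` bound the second by
  `ε⁻¹ (P_ℤ(|C(0)| ≥ ⌈εn³⌉) − θ(p_c)) → 0` (`tendsto_real_clusterSizeGe`).
* The converse crux ⇒ S3 is `sfMass_subextensive_of_noCriticalTorusGiant`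
  (`…TransferConverse.lean`, p150460), so S3 is crux-EQUIVALENT; this is why lead c3 reshaped the
  line (universal-tightness transfer, skeleton §2) instead of keeping S3 as a stub.

No new definitions; the slice-filling predicate is written out
(`∃ i : Fin 3, ∀ t : ZMod n, ∃ y ∈ C(x), y i = t`) as everywhere in the route.
-/

noncomputable section

namespace Summit.CriticalPhenomena.PercolationContinuityZ3.Theorems.PercTorusSliceFillingNoCriticalTorusGiant

open MeasureTheory Filter Topology
open Literature.Probability.Percolation Literature.Probability.LatticeModels

namespace SfTransfer

/-- Abstract squeeze used by the composition: a non-negative real sequence eventually bounded by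
`c · I n + c' · J n` with `I → 0` and `J → 0` tends to `0`. [folklore] -/
theorem tendsto_zero_of_eventually_le_add {g I J : ℕ → ℝ} (c c' : ℝ) (hg : ∀ n, 0 ≤ g n)
    (hle : ∀ᶠ n in atTop, g n ≤ c * I n + c' * J n) (hI : Tendsto I atTop (nhds 0))
    (hJ : Tendsto J atTop (nhds 0)) : Tendsto g atTop (nhds 0) := by
  have hup : Tendsto (fun n => c * I n + c' * J n) atTop (nhds 0) := by
    simpa using (hI.const_mul c).add (hJ.const_mul c')
  exact tendsto_of_tendsto_of_tendsto_of_le_of_le' tendsto_const_nhds hup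
    (Eventually.of_forall hg) hle

/-- `⌈ε n³⌉ → ∞` along the naturals, for `ε > 0`. [folklore] -/
theorem tendsto_ceil_mul_pow_three {ε : ℝ} (hε : 0 < ε) :
    Tendsto (fun n : ℕ => ⌈ε * (n : ℝ) ^ 3⌉₊) atTop atTop := by
  refine tendsto_nat_ceil_atTop.comp ?_
  refine Tendsto.const_mul_atTop hε ?_
  exact (tendsto_pow_atTop (by norm_num : (3 : ℕ) ≠ 0)).comp tendsto_natCast_atTop_atTop

/-- The finite-cluster tail `P_{ℤ³,p}(|C(0)| ≥ ⌈ε n³⌉) − θ(p) → 0` (`P(|C(0)| ≥ k) ↓ θ`,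
`tendsto_real_clusterSizeGe`, along `⌈εn³⌉ → ∞`). [folklore] -/
theorem tendsto_finiteTail {ε : ℝ} (hε : 0 < ε) (p : unitInterval) :
    Tendsto (fun n : ℕ => (bondPercolation (zdGraph 3) p).real
        (clusterSizeGe (0 : Site 3) ⌈ε * (n : ℝ) ^ 3⌉₊) - theta (zdGraph 3) 0 p)
      atTop (nhds 0) := by
  have h := (tendsto_real_clusterSizeGe (zdGraph 3) (0 : Site 3) p).comp
    (tendsto_ceil_mul_pow_three hε)
  have h' := h.sub_const (theta (zdGraph 3) 0 p)
  simpa using h'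

end SfTransfer

/-- **S3 ⇒ crux (the slice-filling transfer).**  Subextensivity of the slice-filling susceptibility of
the critical 3-torus implies the crux `PercTorusSliceFilling.NoCriticalTorusGiant`, concluded BY NAME,
via the LANDED stubs S1a `stub_nonSfLargeClusterChart`, S1b `stub_nonSfGiantMarkov`, S2a
`stub_sfGiantSecondMoment`, S2b `stub_sfMassTransitive`.  For `ε > 0` and `n ≥ 3` put
`k = ⌈ε n³⌉ ≥ 1`; then `{∃ x, |C(x)| ≥ εn³} ⊆ {∃ x, k ≤ |C(x)| ∧ sf_x} ∪ {∃ x, k ≤ |C(x)| ∧ ¬sf_x}`,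
so by S2a+S2b and S1b+S1a
`P(ε-giant) ≤ (n³/k²)·E[|C(0)|; sf_0] + (n³/k)·(P_ℤ(|C(0)| ≥ k) − θ)
           ≤ ε⁻² · E[|C(0)|; sf_0]/n³ + ε⁻¹ · (P_ℤ(|C(0)| ≥ ⌈εn³⌉) − θ) → 0`
by the hypothesis S3 and `SfTransfer.tendsto_finiteTail`. [folklore] -/
theorem noCriticalTorusGiant_of_sfMass_subextensive : Tendsto (fun n : ℕ => (∫ ω, {ω' | ∃ i : Fin 3, ∀ t : ZMod n, ∃ y ∈ openCluster ω' (0 : TorusSite 3 n), y i = t}.indicator (fun ω' => ((openCluster ω' (0 : TorusSite 3 n)).ncard : ℝ)) ω ∂(bondPercolation (torusGraph 3 n) (criticalProbI 3))) / (n : ℝ) ^ 3) atTop (nhds 0) → Summit.CriticalPhenomena.PercolationContinuityZ3.Theses.PercTorusSliceFilling.NoCriticalTorusGiant := by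
  intro h₃ ε hε
  refine SfTransfer.tendsto_zero_of_eventually_le_add (ε⁻¹ ^ 2) ε⁻¹ (fun n => measureReal_nonneg) ?_ h₃
    (SfTransfer.tendsto_finiteTail hε (criticalProbI 3))
  filter_upwards [eventually_ge_atTop 3] with n hn
  -- fixed `n ≥ 3`; `k := ⌈ε n³⌉`
  haveI : NeZero n := ⟨by omega⟩
  set P := bondPercolation (torusGraph 3 n) (criticalProbI 3) with hP
  set k : ℕ := ⌈ε * (n : ℝ) ^ 3⌉₊ with hk
  have hn3 : (0 : ℝ) < (n : ℝ) ^ 3 := by positivity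
  have hεn : 0 < ε * (n : ℝ) ^ 3 := mul_pos hε hn3
  have hk1 : 1 ≤ k := Nat.ceil_pos.mpr hεn
  have hk0 : (0 : ℝ) < k := by exact_mod_cast hk1
  have hkge : ε * (n : ℝ) ^ 3 ≤ (k : ℝ) := Nat.le_ceil _
  have hcard : (Finset.univ : Finset (TorusSite 3 n)).card = n ^ 3 := by
    rw [Finset.card_univ]; simp [ZMod.card, Finset.prod_const]
  -- the two events and the split of the ε-giant event
  set SF : Set (BondConfig (TorusSite 3 n)) :=
    {ω | ∃ x : TorusSite 3 n, k ≤ (openCluster ω x).ncard ∧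
      ∃ i : Fin 3, ∀ t : ZMod n, ∃ y ∈ openCluster ω x, y i = t} with hSF
  set NSF : Set (BondConfig (TorusSite 3 n)) :=
    {ω | ∃ x : TorusSite 3 n, k ≤ (openCluster ω x).ncard ∧
      ¬ ∃ i : Fin 3, ∀ t : ZMod n, ∃ y ∈ openCluster ω x, y i = t} with hNSF
  have hsub : {ω : BondConfig (TorusSite 3 n) |
      ∃ x : TorusSite 3 n, ε * (n : ℝ) ^ 3 ≤ ((openCluster ω x).ncard : ℝ)} ⊆ SF ∪ NSF := by
    rintro ω ⟨x, hx⟩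
    by_cases hs : ∃ i : Fin 3, ∀ t : ZMod n, ∃ y ∈ openCluster ω x, y i = t
    · exact Or.inl ⟨x, Nat.ceil_le.mpr hx, hs⟩
    · exact Or.inr ⟨x, Nat.ceil_le.mpr hx, hs⟩
  -- the slice-filling mass functional at `x` and its mean
  set M : TorusSite 3 n → ℝ := fun x =>
    ∫ ω, {ω' | ∃ i : Fin 3, ∀ t : ZMod n, ∃ y ∈ openCluster ω' x, y i = t}.indicator
      (fun ω' => ((openCluster ω' x).ncard : ℝ)) ω ∂P with hM
  have hM0 : 0 ≤ M 0 :=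
    integral_nonneg fun ω => Set.indicator_nonneg (fun _ _ => Nat.cast_nonneg _) ω
  -- slice-filling part: S2a + S2b
  have hA : P.real SF ≤ ((k : ℝ) ^ 2)⁻¹ * ((n : ℝ) ^ 3 * M 0) := by
    have h := stub_sfGiantSecondMoment (criticalProbI 3) n k hk1
    have hsum : ∑ x : TorusSite 3 n, M x = (n : ℝ) ^ 3 * M 0 := by
      have : ∀ x ∈ (Finset.univ : Finset (TorusSite 3 n)), M x = M 0 :=
        fun x _ => stub_sfMassTransitive (criticalProbI 3) n x
      rw [Finset.sum_congr rfl this, Finset.sum_const, hcard, nsmul_eq_mul]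
      push_cast; ring
    rw [← hsum]
    exact h
  -- non-slice-filling part: S1b + S1a
  set τ : ℝ := (bondPercolation (zdGraph 3) (criticalProbI 3)).real (clusterSizeGe (0 : Site 3) k) -
    theta (zdGraph 3) 0 (criticalProbI 3) with hτ
  have hB : P.real NSF ≤ (k : ℝ)⁻¹ * ((n : ℝ) ^ 3 * τ) := by
    have h := stub_nonSfGiantMarkov (criticalProbI 3) n k hk1
    have hle : ∑ x : TorusSite 3 n, P.real
        {ω | k ≤ (openCluster ω x).ncard ∧
          ¬ ∃ i : Fin 3, ∀ t : ZMod n, ∃ y ∈ openCluster ω x, y i = t} ≤ (n : ℝ) ^ 3 * τ := by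
      calc ∑ x : TorusSite 3 n, P.real
            {ω | k ≤ (openCluster ω x).ncard ∧
              ¬ ∃ i : Fin 3, ∀ t : ZMod n, ∃ y ∈ openCluster ω x, y i = t}
          ≤ ∑ _x : TorusSite 3 n, τ :=
            Finset.sum_le_sum fun x _ => stub_nonSfLargeClusterChart (criticalProbI 3) n hn x k
        _ = (n : ℝ) ^ 3 * τ := by
            rw [Finset.sum_const, hcard, nsmul_eq_mul]; push_cast; ring
    exact h.trans (mul_le_mul_of_nonneg_left hle (inv_nonneg.2 hk0.le))
  have hτ0 : 0 ≤ τ := by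
    have h := stub_nonSfLargeClusterChart (criticalProbI 3) n hn 0 k
    exact le_trans measureReal_nonneg h
  -- coefficients: `n³/k² ≤ ε⁻²/n³` and `n³/k ≤ ε⁻¹`
  have hcoefA : ((k : ℝ) ^ 2)⁻¹ * ((n : ℝ) ^ 3 * M 0) ≤ ε⁻¹ ^ 2 * (M 0 / (n : ℝ) ^ 3) := by
    have h1 : ((k : ℝ) ^ 2)⁻¹ ≤ ((ε * (n : ℝ) ^ 3) ^ 2)⁻¹ :=
      inv_anti₀ (pow_pos hεn 2) (pow_le_pow_left₀ hεn.le hkge 2)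
    calc ((k : ℝ) ^ 2)⁻¹ * ((n : ℝ) ^ 3 * M 0)
        ≤ ((ε * (n : ℝ) ^ 3) ^ 2)⁻¹ * ((n : ℝ) ^ 3 * M 0) :=
          mul_le_mul_of_nonneg_right h1 (mul_nonneg hn3.le hM0)
      _ = ε⁻¹ ^ 2 * (M 0 / (n : ℝ) ^ 3) := by
          field_simp
  have hcoefB : (k : ℝ)⁻¹ * ((n : ℝ) ^ 3 * τ) ≤ ε⁻¹ * τ := by
    have h1 : (k : ℝ)⁻¹ ≤ (ε * (n : ℝ) ^ 3)⁻¹ := inv_anti₀ hεn hkge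
    calc (k : ℝ)⁻¹ * ((n : ℝ) ^ 3 * τ)
        ≤ (ε * (n : ℝ) ^ 3)⁻¹ * ((n : ℝ) ^ 3 * τ) :=
          mul_le_mul_of_nonneg_right h1 (mul_nonneg hn3.le hτ0)
      _ = ε⁻¹ * τ := by
          field_simp
  calc P.real {ω | ∃ x : TorusSite 3 n, ε * (n : ℝ) ^ 3 ≤ ((openCluster ω x).ncard : ℝ)}
      ≤ P.real (SF ∪ NSF) := measureReal_mono hsub
    _ ≤ P.real SF + P.real NSF := measureReal_union_le _ _
    _ ≤ ε⁻¹ ^ 2 * (M 0 / (n : ℝ) ^ 3) + ε⁻¹ * τ :=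
        add_le_add (hA.trans hcoefA) (hB.trans hcoefB)


end Summit.CriticalPhenomena.PercolationContinuityZ3.Theorems.PercTorusSliceFillingNoCriticalTorusGiant

end
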